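import Summits.AnomalousDissipation.AnomalousDissipation.Theses.ErgodicMirrorGate
import Summits.AnomalousDissipation.AnomalousDissipation.Theorems.ErgodicMirrorGateNoThinMirrorClimateTGTools
import Summits.AnomalousDissipation.AnomalousDissipation.Theorems.MirrorEnsembleMirrorStatisticsLoudTGStubTubeProfilesK
import Summits.AnomalousDissipation.AnomalousDissipation.Theorems.MirrorEnsembleMirrorStatisticsLoudTGStubOddPoincareK
import Summits.AnomalousDissipation.AnomalousDissipation.Theorems.MirrorEnsembleMirrorStatisticsLoudTGStubTubeLawSmoothK
import Summits.AnomalousDissipation.AnomalousDissipation.Theorems.MirrorEnsembleMirrorStatisticsLoudTGStubTubeLawTransferK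
import Literature.Analysis.FluidPDE.PassiveVectorWeakGradientHighModePairing
import Literature.Analysis.FluidPDE.EnergySpaceTorusProofs
import Literature.Analysis.FunctionSpaces.TorusTestFunctionProofs
import HarnessLib

/-!
# `NoThinMirrorClimateTG` holds (route `ErgodicMirrorGate`, item stmt-AnomalousDissipation-27270)

**Statement (split child A of the deciding crux `NoMirrorEulerClimateTG`).** At the pinned Taylor–Green force
`f_TG`, no inviscid limit climate of the mirror class — a probability space `(Ω, P)` with a measure-preserving
shift `S`, paths `ω ↦ u_ω` with `u_{Sω}(t) = u_ω(t+1)` solving the space–time weak Euler formulation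
(`Torus.IsWeakNSSolutionForcedOn T 0 f_TG (u_ω 0) u_ω` for all `T > 0`), a.e. `K`-symmetric at every time,
with measurable slices and finite mean energy — is THIN AT THE SKELETON: for `η > 0` there are arbitrarily small
`δ` with `E ∫₀¹ inf_g ∫_{T_δ} ∑ⱼ ‖gⱼ(u_ω(s))‖² ds ≤ η δ`, the infimum over square-integrable weak gradients `g`
of the slice and `T_δ` the `δ`-tube of the skeleton edge grid `{x₂ = 0, x₀ or x₁ ∈ {0, ½}}`.

**Proof (Kelvin circulation balance on the skeleton loop, averaged over the climate).** Let `w = w_{δ/3}` be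
the TUBE CURRENT of T1 `stub_tubeProfilesK` (smooth, solenoidal, PUMP `p = (f_TG, w) ≥ 1`) and
`a(ω) = (u_ω(0), w)`. The WINDOW IDENTITY (`window_identity`: the weak formulation of `u_ω` and of the shifted
path `u_{Sω} = u_ω(·+1)` on `[0,2)`, tested with a time cut-off times `w`) gives, for EVERY `ω`,
`a(Sω) − a(ω) = I(ω) + p`, `I(ω) = ∫₀¹ ∫ ⟪u_ω(s), (u_ω(s)·∇)w⟫ ds`. At a.e. time the slice is an `L²`,
weakly divergence-free, a.e. `K`-symmetric (hence mean-zero) field, i.e. a member of `Fix K ⊆ H`; by the KELVIN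
TUBE LAW (T2 `stub_tubeLawSmoothK stub_oddPoincareK`) transferred to such classes (T3 `stub_tubeLawTransferK`,
with ANY square-integrable weak gradient as majorant by uniqueness of weak derivatives, `slice_bound`),
`|∫ ⟪u, (u·∇)w⟫| ≤ (3KA³/δ) inf_g ∫_{N_{δ/3}} ∑ⱼ ‖gⱼ‖²` with `N_{δ/3} ⊆ T_δ`. Lower integration in `s` and `ω`
(no measurability of the infimum is needed) and thinness at `η₀ = 1/(4KA³)` give `E|I| ≤ 3/4`, so `I` is
integrable (it is measurable, being `a∘S − a − p` with `a` measurable by the slice measurability hypothesis).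
Hence `a∘S − a` is integrable and, `S` preserving `P`, `E(a∘S − a) = 0` (COBOUNDARY LEMMA
`integral_comp_sub_eq_zero`; no integrability of `a` is needed). Therefore `p = −E I ≤ 3/4 < 1 ≤ p`.

References: M. E. Brachet, D. I. Meiron, S. A. Orszag, B. G. Nickel, R. H. Morf, U. Frisch, *Small-scale
structure of the Taylor–Green vortex*, J. Fluid Mech. 130 (1983) 411–452, §2 [doi:10.1017/s0022112083001159];
R. Temam, *Navier–Stokes Equations* (3rd ed., North-Holland 1984), Ch. III §1 [Temam1984]; C. Foias, O. Manley,
R. Rosa, R. Temam, *Navier–Stokes Equations and Turbulence* (CUP 2001), Ch. IV §1 [FMRTTurbulence2001];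
L. C. Evans, *Partial Differential Equations*, 2nd ed. (AMS 2010), §5.2.1 [Evans2010].
-/

-- every `Summit.AnomalousDissipation.AnomalousDissipation.…` name repeats the summit = problem segment (tree layout)
set_option linter.dupNamespace false

noncomputable section

namespace Summit.AnomalousDissipation.AnomalousDissipation.Theorems.ErgodicMirrorGateNoThinMirrorClimateTG

open MeasureTheory Filter Topology Set Function
open scoped ENNReal InnerProductSpace NNReal RealInnerProductSpace
open Literature.Analysis.FunctionSpaces Literature.Analysis.FluidPDE
open Summit.AnomalousDissipation.AnomalousDissipation.Theorems.TaylorGreenLoudGalerkinStates.Negative (tgForce)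
open Summit.AnomalousDissipation.AnomalousDissipation.Theorems.MirrorStatisticsLoudTG.Negative
  (mirrorClass memLp_tgForce measurePreserving_reflect)
open Summit.AnomalousDissipation.AnomalousDissipation.Theorems.MirrorEnsembleMirrorStatisticsLoudTG
  (stub_tubeProfilesK stub_oddPoincareK stub_tubeLawSmoothK stub_tubeLawTransferK)

/-! ### §4 The mirror class at a time slice -/

/-- An integrable a.e. `K`-symmetric field on `T³` (`v_j(R_i x) = ∓ v_j(x)` a.e., `R_i x = update x i (−x i)`)
has zero mean: each component is odd under the corresponding volume-preserving reflection. [folklore] -/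
theorem integral_eq_zero_of_mirror {v : UnitAddTorus (Fin 3) → EuclideanSpace ℝ (Fin 3)}
    (hv : Integrable v volume)
    (hK : ∀ i j : Fin 3, (fun x => v (update x i (-x i)) j) =ᵐ[volume]
      fun x => if j = i then -(v x j) else v x j) :
    ∫ x, v x = 0 := by
  have hc : ∀ j : Fin 3, ∫ x, v x j = 0 := by
    intro j
    have hvj : Integrable (fun x => v x j) volume := (EuclideanSpace.proj (𝕜 := ℝ) j).integrable_comp hv
    have h1 : ∫ x, v (update x j (-x j)) j = ∫ x, v x j := by
      have hm := measurePreserving_reflect j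
      have h := integral_map hm.measurable.aemeasurable (f := fun x => v x j)
        (by rw [hm.map_eq]; exact hvj.aestronglyMeasurable)
      rw [hm.map_eq] at h
      exact h.symm
    have h2 : ∫ x, v (update x j (-x j)) j = -∫ x, v x j := by
      rw [← integral_neg]
      refine integral_congr_ae ?_
      filter_upwards [hK j j] with x hx
      simpa using hx
    linarith
  refine PiLp.ext fun j => ?_
  have h := (EuclideanSpace.proj (𝕜 := ℝ) j).integral_comp_comm hv
  change ∫ x, v x j = (∫ x, v x) j at h
  rw [← h, hc j]
  rfl

/-- **Slice bound.** If the smooth tube law with constant `C/δ` holds for the smooth field `w` on the tube `N_δ`,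
then for every `L²`, weakly divergence-free, a.e. `K`-symmetric field `U` with a square-integrable weak gradient
`g`: `ofReal |∫ ⟪U, (U·∇)w⟫| ≤ ofReal (C/δ) · ∫⁻_{N_δ} ∑ⱼ ‖gⱼ‖ₑ²` — the `L²` class of `U` lies in `Fix K ⊆ H`
(zero mean by `integral_eq_zero_of_mirror`, `Torus.mem_energySpace_of_isWeaklyDivFree_of_hasZeroMean`), has
finite enstrophy (`Torus.eGradNormSq_eq_lintegral_of_hasWeakPartialDeriv`), and `g` majorises the local enstrophy
of every square-integrable weak gradient by uniqueness of weak derivatives (Evans 2010, §5.2.1;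
`Torus.HasWeakPartialDeriv.unique_holds`), so T3 `stub_tubeLawTransferK` applies. [folklore] -/
theorem slice_bound {C δ : ℝ} (hC : 0 ≤ C) (hδ : 0 < δ)
    {w : UnitAddTorus (Fin 3) → EuclideanSpace ℝ (Fin 3)} (hws : Torus.IsSmooth w)
    (hsm : ∀ v : UnitAddTorus (Fin 3) → EuclideanSpace ℝ (Fin 3), Torus.IsSmooth v → Torus.IsDivFree v →
      Torus.HasZeroMean v →
      (∀ (i j : Fin 3) (x : UnitAddTorus (Fin 3)), v (update x i (-x i)) j = if j = i then -(v x j) else v x j) →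
      |∫ x, ⟪Torus.fderiv w x (v x), v x⟫_ℝ| ≤
        C / δ * ∫ x in {x : UnitAddTorus (Fin 3) | ‖x 2‖ ≤ δ ∧ (‖x 0‖ ≤ 2 * δ ∨
            ‖x 0 - ((2⁻¹ : ℝ) : UnitAddCircle)‖ ≤ 2 * δ ∨ ‖x 1‖ ≤ 2 * δ ∨ ‖x 1 - ((2⁻¹ : ℝ) : UnitAddCircle)‖ ≤ 2 * δ)},
          ∑ j, ‖Torus.partialDeriv j v x‖ ^ 2)
    {U : UnitAddTorus (Fin 3) → EuclideanSpace ℝ (Fin 3)} (hU : MemLp U 2 volume)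
    (hdiv : Torus.IsWeaklyDivFree U)
    (hK : ∀ i j : Fin 3, (fun x => U (update x i (-x i)) j) =ᵐ[volume]
      fun x => if j = i then -(U x j) else U x j)
    {g : Fin 3 → UnitAddTorus (Fin 3) → EuclideanSpace ℝ (Fin 3)} (hg2 : ∀ j, MemLp (g j) 2 volume)
    (hg : ∀ j, Torus.HasWeakPartialDeriv j U (g j)) :
    ENNReal.ofReal |∫ x, ⟪U x, Torus.convect U w x⟫| ≤
      ENNReal.ofReal (C / δ) * ∫⁻ x in {x : UnitAddTorus (Fin 3) | ‖x 2‖ ≤ δ ∧ (‖x 0‖ ≤ 2 * δ ∨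
          ‖x 0 - ((2⁻¹ : ℝ) : UnitAddCircle)‖ ≤ 2 * δ ∨ ‖x 1‖ ≤ 2 * δ ∨ ‖x 1 - ((2⁻¹ : ℝ) : UnitAddCircle)‖ ≤ 2 * δ)},
        ∑ j, ‖g j x‖ₑ ^ 2 := by
  -- the `L²` class of `U` and its membership in `Fix K ⊆ H`
  set V : Lp (EuclideanSpace ℝ (Fin 3)) 2 (volume : Measure (UnitAddTorus (Fin 3))) := hU.toLp U with hVdef
  have hVU : (V : UnitAddTorus (Fin 3) → EuclideanSpace ℝ (Fin 3)) =ᵐ[volume] U := hU.coeFn_toLp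
  have hVdiv : Torus.IsWeaklyDivFree (V : UnitAddTorus (Fin 3) → EuclideanSpace ℝ (Fin 3)) := fun θ hθ => by
    rw [← hdiv θ hθ]
    exact integral_congr_ae (by filter_upwards [hVU] with x hx; rw [hx])
  have hV0 : Torus.HasZeroMean (V : UnitAddTorus (Fin 3) → EuclideanSpace ℝ (Fin 3)) := by
    unfold Torus.HasZeroMean
    rw [integral_congr_ae hVU]
    exact integral_eq_zero_of_mirror (hU.integrable one_le_two) hK
  have hVH : V ∈ Torus.energySpace (Fin 3) := Torus.mem_energySpace_of_isWeaklyDivFree_of_hasZeroMean hVdiv hV0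
  have hvK : (⟨V, hVH⟩ : Torus.energySpace (Fin 3)) ∈ mirrorClass := by
    intro i i'
    have h1 : (fun x => (V : UnitAddTorus (Fin 3) → EuclideanSpace ℝ (Fin 3)) (update x i (-x i))) =ᵐ[volume]
        fun x => U (update x i (-x i)) :=
      (measurePreserving_reflect i).quasiMeasurePreserving.ae_eq_comp hVU
    filter_upwards [h1, hK i i', hVU] with x hx1 hx2 hx3
    change (V : UnitAddTorus (Fin 3) → EuclideanSpace ℝ (Fin 3)) (update x i (-x i)) i' =
      if i' = i then -((V : UnitAddTorus (Fin 3) → EuclideanSpace ℝ (Fin 3)) x i')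
      else (V : UnitAddTorus (Fin 3) → EuclideanSpace ℝ (Fin 3)) x i'
    rw [hx1, hx2, hx3]
  -- a square-integrable weak gradient of the class: finite enstrophy, and `g` is an admissible majorant
  have hgV : ∀ j, Torus.HasWeakPartialDeriv j (V : UnitAddTorus (Fin 3) → EuclideanSpace ℝ (Fin 3)) (g j) :=
    fun j φ hφ => by
    rw [← hg j φ hφ]
    exact integral_congr_ae (by filter_upwards [hVU] with x hx; rw [hx])
  have hG : Torus.eGradNormSq (V : UnitAddTorus (Fin 3) → EuclideanSpace ℝ (Fin 3)) ≠ ⊤ := by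
    rw [Torus.eGradNormSq_eq_lintegral_of_hasWeakPartialDeriv (Lp.memLp V) hg2 hgV,
      lintegral_finsetSum' _ fun j _ => ((hg2 j).1.enorm.pow_const 2)]
    refine (ENNReal.sum_lt_top.2 fun j _ => ?_).ne
    rw [Torus.lintegral_enorm_sq_eq_ofReal (hg2 j)]
    exact ENNReal.ofReal_lt_top
  have hΛ : ∀ w' : Fin 3 → UnitAddTorus (Fin 3) → EuclideanSpace ℝ (Fin 3),
      (∀ j, Torus.HasWeakPartialDeriv j (V : UnitAddTorus (Fin 3) → EuclideanSpace ℝ (Fin 3)) (w' j)) →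
      (∀ j, MemLp (w' j) 2 volume) →
      ∫⁻ x in {x : UnitAddTorus (Fin 3) | ‖x 2‖ ≤ δ ∧ (‖x 0‖ ≤ 2 * δ ∨
          ‖x 0 - ((2⁻¹ : ℝ) : UnitAddCircle)‖ ≤ 2 * δ ∨ ‖x 1‖ ≤ 2 * δ ∨ ‖x 1 - ((2⁻¹ : ℝ) : UnitAddCircle)‖ ≤ 2 * δ)},
        ∑ j, ‖w' j x‖ₑ ^ 2 ≤
      ∫⁻ x in {x : UnitAddTorus (Fin 3) | ‖x 2‖ ≤ δ ∧ (‖x 0‖ ≤ 2 * δ ∨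
          ‖x 0 - ((2⁻¹ : ℝ) : UnitAddCircle)‖ ≤ 2 * δ ∨ ‖x 1‖ ≤ 2 * δ ∨ ‖x 1 - ((2⁻¹ : ℝ) : UnitAddCircle)‖ ≤ 2 * δ)},
        ∑ j, ‖g j x‖ₑ ^ 2 := by
    intro w' hw' hw'2
    have hae : ∀ j, w' j =ᵐ[volume] g j := fun j =>
      Torus.HasWeakPartialDeriv.unique_holds (d := Fin 3) (EuclideanSpace ℝ (Fin 3))
        ((hw'2 j).integrable one_le_two) ((hg2 j).integrable one_le_two) (hw' j) (hgV j)
    refine (lintegral_congr_ae (ae_restrict_of_ae ?_)).le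
    filter_upwards [ae_all_iff.2 hae] with x hx
    exact Finset.sum_congr rfl fun j _ => by rw [hx j]
  -- T3, and the inertial pairing of the class is that of `U`
  have key := stub_tubeLawTransferK C δ w hC hδ hws hsm ⟨V, hVH⟩ hvK hG _ hΛ
  have hI : Torus.inertialPairing V w = ∫ x, ⟪U x, Torus.convect U w x⟫ := by
    unfold Torus.inertialPairing Torus.convect
    refine integral_congr_ae ?_
    filter_upwards [hVU] with x hx
    rw [hx, real_inner_comm]
  rw [← hI]
  exact key

/-! ### §5 The theorem -/

/-- The slice pairing `ω ↦ (X_ω, Ψ)` of a jointly measurable random field with a continuous field is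
measurable. [folklore] -/
theorem measurable_integral_inner {Ω : Type*} [MeasurableSpace Ω]
    {X : Ω → UnitAddTorus (Fin 3) → EuclideanSpace ℝ (Fin 3)} (hX : Measurable (uncurry X))
    {Ψ : UnitAddTorus (Fin 3) → EuclideanSpace ℝ (Fin 3)} (hΨ : Continuous Ψ) :
    Measurable fun z => ∫ x, ⟪X z x, Ψ x⟫ := by
  have h1 : StronglyMeasurable (uncurry fun z x => ⟪X z x, Ψ x⟫) :=
    hX.stronglyMeasurable.inner (𝕜 := ℝ) (hΨ.measurable.comp measurable_snd).stronglyMeasurable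
  exact (StronglyMeasurable.integral_prod_right h1).measurable

/-- **`NoThinMirrorClimateTG` holds** (route `ErgodicMirrorGate`, split child A of `NoMirrorEulerClimateTG`):
at the pinned Taylor–Green force no inviscid measure-preserving weak-Euler climate of the mirror class with
finite mean energy is thin at the skeleton. Kelvin circulation balance on the skeleton loop, averaged over the
climate: with the tube current `w` of width `δ/3` (T1, pump `(f_TG, w) ≥ 1`) and `a(ω) = (u_ω(0), w)`, the
window identity gives `a∘S − a = I + (f_TG, w)` pathwise, the transferred tube law (T2/T3) and thinness give
`E|I| ≤ 3/4`, and the coboundary `a∘S − a` has mean zero — contradiction. [folklore] -/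
theorem noThinMirrorClimateTG : Theses.ErgodicMirrorGate.NoThinMirrorClimateTG := by
  intro f hf E M Ω _ P S traj hP hS hshift hsol hK hmE hmM hE hM hthin
  obtain ⟨hmeas, hthin⟩ := hthin
  have hfT : f = tgForce := hf
  subst hfT
  -- T1/T2: the tube machine of line `regimes`
  obtain ⟨A, δ₁, hA, hδ₁, hδ₁le, hprof⟩ := stub_tubeProfilesK
  obtain ⟨K, hK0, htube⟩ := stub_tubeLawSmoothK stub_oddPoincareK
  have hA0 : 0 < A := lt_of_lt_of_le one_pos hA
  have hKA : 0 < K * A ^ 3 := by positivity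
  -- a thin tube at `η₀ = 1/(4KA³)`, of width `δ < δ₁`
  obtain ⟨δ, hδ, hδlt, hδthin⟩ := hthin (1 / (4 * (K * A ^ 3))) (by positivity) δ₁ hδ₁
  have hδ3 : 0 < δ / 3 := by positivity
  have hδ3le : δ / 3 ≤ δ₁ := by linarith
  have hδ316 : δ / 3 ≤ 16⁻¹ := hδ3le.trans hδ₁le
  -- the tube current `w` of width `δ/3`, its pump and the smooth tube law for it
  obtain ⟨ρ, ηp, hρs, hηs, hρp, hηp, hηb, hρb, hρ'b, hηsupp, hρ'supp, hws', hwd', hwz', hfw'⟩ :=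
    hprof (δ / 3) hδ3 hδ3le
  have hsm' := htube A (δ / 3) ρ ηp hA hδ3 hδ316 hρs hηs hρp hηp hηb hρb hρ'b hηsupp hρ'supp
  obtain ⟨w, hws, hwd, hfw, hsm⟩ : ∃ w : UnitAddTorus (Fin 3) → EuclideanSpace ℝ (Fin 3),
      Torus.IsSmooth w ∧ Torus.IsDivFree w ∧ 1 ≤ ∫ x, ⟪tgForce x, w x⟫_ℝ ∧
      ∀ v : UnitAddTorus (Fin 3) → EuclideanSpace ℝ (Fin 3), Torus.IsSmooth v → Torus.IsDivFree v →
        Torus.HasZeroMean v →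
        (∀ (i j : Fin 3) (x : UnitAddTorus (Fin 3)), v (update x i (-x i)) j = if j = i then -(v x j) else v x j) →
        |∫ x, ⟪Torus.fderiv w x (v x), v x⟫_ℝ| ≤
          K * A ^ 3 / (δ / 3) * ∫ x in {x : UnitAddTorus (Fin 3) | ‖x 2‖ ≤ δ / 3 ∧ (‖x 0‖ ≤ 2 * (δ / 3) ∨
              ‖x 0 - ((2⁻¹ : ℝ) : UnitAddCircle)‖ ≤ 2 * (δ / 3) ∨ ‖x 1‖ ≤ 2 * (δ / 3) ∨
              ‖x 1 - ((2⁻¹ : ℝ) : UnitAddCircle)‖ ≤ 2 * (δ / 3))},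
            ∑ j, ‖Torus.partialDeriv j v x‖ ^ 2 :=
    ⟨_, hws', hwd', hfw', hsm'⟩
  -- `N_{δ/3} ⊆ T_δ`
  have e12 : (1 / 2 : ℝ) = 2⁻¹ := one_div 2
  have hsub : {x : UnitAddTorus (Fin 3) | ‖x 2‖ ≤ δ / 3 ∧ (‖x 0‖ ≤ 2 * (δ / 3) ∨
      ‖x 0 - ((2⁻¹ : ℝ) : UnitAddCircle)‖ ≤ 2 * (δ / 3) ∨ ‖x 1‖ ≤ 2 * (δ / 3) ∨
      ‖x 1 - ((2⁻¹ : ℝ) : UnitAddCircle)‖ ≤ 2 * (δ / 3))} ⊆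
      {x : UnitAddTorus (Fin 3) | (‖x 1‖ < δ ∨ ‖x 1 - ((1 / 2 : ℝ) : UnitAddCircle)‖ < δ ∨ ‖x 0‖ < δ ∨
        ‖x 0 - ((1 / 2 : ℝ) : UnitAddCircle)‖ < δ) ∧ ‖x 2‖ < δ} := by
    intro x hx
    rw [Set.mem_setOf_eq] at hx ⊢
    rw [e12]
    obtain ⟨h2, h01⟩ := hx
    have hlt1 : δ / 3 < δ := by linarith
    have hlt2 : 2 * (δ / 3) < δ := by linarith
    refine ⟨?_, h2.trans_lt hlt1⟩
    rcases h01 with h | h | h | h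
    · exact Or.inr (Or.inr (Or.inl (h.trans_lt hlt2)))
    · exact Or.inr (Or.inr (Or.inr (h.trans_lt hlt2)))
    · exact Or.inl (h.trans_lt hlt2)
    · exact Or.inr (Or.inl (h.trans_lt hlt2))
  -- the pathwise bound on the inertial window integral `I(ω) = ∫₀¹ ∫ ⟪u, (u·∇)w⟫`
  have hbound : ∀ z : Ω, ‖∫ s in Ioo (0 : ℝ) 1, ∫ x, ⟪traj z s x, Torus.convect (traj z s) w x⟫‖ₑ ≤
      ENNReal.ofReal (K * A ^ 3 / (δ / 3)) * ∫⁻ s in Ioo (0 : ℝ) 1,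
        ⨅ (g : Fin 3 → UnitAddTorus (Fin 3) → EuclideanSpace ℝ (Fin 3))
          (_ : ∀ j : Fin 3, MemLp (g j) 2 volume ∧ Torus.HasWeakPartialDeriv j (traj z s) (g j)),
          ∫⁻ x in {x : UnitAddTorus (Fin 3) | (‖x 1‖ < δ ∨ ‖x 1 - ((1 / 2 : ℝ) : UnitAddCircle)‖ < δ ∨
              ‖x 0‖ < δ ∨ ‖x 0 - ((1 / 2 : ℝ) : UnitAddCircle)‖ < δ) ∧ ‖x 2‖ < δ},
            ∑ j : Fin 3, ‖g j x‖ₑ ^ 2 := by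
    intro z
    have hsol1 := hsol z 1 one_pos
    have hne : ENNReal.ofReal (K * A ^ 3 / (δ / 3)) ≠ 0 := (ENNReal.ofReal_pos.2 (by positivity)).ne'
    refine (enorm_integral_le_lintegral_enorm _).trans ?_
    rw [← lintegral_const_mul' _ _ ENNReal.ofReal_ne_top]
    refine lintegral_mono_ae ?_
    filter_upwards [ae_memLp_two hsol1, hsol1.ae_isWeaklyDivFree] with s hs2 hsdf
    rw [Real.enorm_eq_ofReal_abs, ENNReal.mul_iInf_of_ne hne ENNReal.ofReal_ne_top]
    refine le_iInf fun g => ?_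
    rw [ENNReal.mul_iInf_of_ne hne ENNReal.ofReal_ne_top]
    refine le_iInf fun hg => ?_
    exact (slice_bound hKA.le hδ3 hws hsm hs2 hsdf (hK z s) (fun j => (hg j).1) (fun j => (hg j).2)).trans
      (mul_le_mul' le_rfl (lintegral_mono_set hsub))
  have hconst : K * A ^ 3 / (δ / 3) * (1 / (4 * (K * A ^ 3)) * δ) = 3 / 4 := by
    field_simp
  have hIint : ∫⁻ z, ‖∫ s in Ioo (0 : ℝ) 1, ∫ x, ⟪traj z s x, Torus.convect (traj z s) w x⟫‖ₑ ∂P ≤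
      ENNReal.ofReal (3 / 4) := by
    refine (lintegral_mono hbound).trans ?_
    rw [lintegral_const_mul' _ _ ENNReal.ofReal_ne_top]
    refine (mul_le_mul' le_rfl hδthin).trans_eq ?_
    rw [← ENNReal.ofReal_mul (by positivity), hconst]
  -- `a(ω) = (u_ω(0), w)` and the window identity `a∘S − a = I + p`, pathwise
  have ha : Measurable fun z => ∫ x, ⟪traj z 0 x, w x⟫ := measurable_integral_inner (hmeas 0) hws.continuous
  have hwin : ∀ z : Ω, (∫ x, ⟪traj (S z) 0 x, w x⟫) - ∫ x, ⟪traj z 0 x, w x⟫ =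
      (∫ s in Ioo (0 : ℝ) 1, ∫ x, ⟪traj z s x, Torus.convect (traj z s) w x⟫) + ∫ x, ⟪tgForce x, w x⟫ :=
    fun z => window_identity (memLp_tgForce.integrable one_le_two) hws hwd (hshift z) (hsol z 2 two_pos)
      (hsol (S z) 2 two_pos)
  -- `I` is measurable and integrable, hence so is the coboundary `a∘S − a`, whose integral vanishes
  have hIm : Measurable fun z => ∫ s in Ioo (0 : ℝ) 1, ∫ x, ⟪traj z s x, Torus.convect (traj z s) w x⟫ := by
    have h : (fun z => ∫ s in Ioo (0 : ℝ) 1, ∫ x, ⟪traj z s x, Torus.convect (traj z s) w x⟫) =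
        fun z => (∫ x, ⟪traj (S z) 0 x, w x⟫) - (∫ x, ⟪traj z 0 x, w x⟫) - ∫ x, ⟪tgForce x, w x⟫ :=
      funext fun z => by linarith [hwin z]
    rw [h]
    exact ((ha.comp hS.measurable).sub ha).sub measurable_const
  have hIi : Integrable (fun z => ∫ s in Ioo (0 : ℝ) 1, ∫ x, ⟪traj z s x, Torus.convect (traj z s) w x⟫) P :=
    ⟨hIm.aestronglyMeasurable, hIint.trans_lt ENNReal.ofReal_lt_top⟩
  have hDi : Integrable (fun z => (∫ x, ⟪traj (S z) 0 x, w x⟫) - ∫ x, ⟪traj z 0 x, w x⟫) P := by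
    have h : (fun z => (∫ x, ⟪traj (S z) 0 x, w x⟫) - ∫ x, ⟪traj z 0 x, w x⟫) =
        fun z => (∫ s in Ioo (0 : ℝ) 1, ∫ x, ⟪traj z s x, Torus.convect (traj z s) w x⟫) +
          ∫ x, ⟪tgForce x, w x⟫ := funext hwin
    rw [h]
    exact hIi.add (integrable_const _)
  have hD0 := integral_comp_sub_eq_zero hS ha hDi
  -- `p = −E I ≤ E|I| ≤ 3/4 < 1 ≤ p`
  have hIP : ∫ z, (∫ s in Ioo (0 : ℝ) 1, ∫ x, ⟪traj z s x, Torus.convect (traj z s) w x⟫) ∂P =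
      -∫ x, ⟪tgForce x, w x⟫ := by
    have h1 : ∫ z, ((∫ x, ⟪traj (S z) 0 x, w x⟫) - ∫ x, ⟪traj z 0 x, w x⟫) ∂P =
        ∫ z, ((∫ s in Ioo (0 : ℝ) 1, ∫ x, ⟪traj z s x, Torus.convect (traj z s) w x⟫) +
          ∫ x, ⟪tgForce x, w x⟫) ∂P := integral_congr_ae (ae_of_all _ hwin)
    rw [hD0, integral_add hIi (integrable_const _), integral_const, probReal_univ, one_smul] at h1
    linarith
  have habs : |∫ z, (∫ s in Ioo (0 : ℝ) 1, ∫ x, ⟪traj z s x, Torus.convect (traj z s) w x⟫) ∂P| ≤ 3 / 4 := by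
    have h := (enorm_integral_le_lintegral_enorm _).trans hIint
    rw [Real.enorm_eq_ofReal_abs] at h
    exact (ENNReal.ofReal_le_ofReal_iff (by norm_num)).1 h
  rw [hIP, abs_neg] at habs
  linarith [le_abs_self (∫ x, ⟪tgForce x, w x⟫)]

end Summit.AnomalousDissipation.AnomalousDissipation.Theorems.ErgodicMirrorGateNoThinMirrorClimateTG

end
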